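import Summits.SmoothPoincare4.SmoothPoincare4.Theses.WeakReductionDescent
import Literature.Topology.FourManifolds.WeaklyReducibleTrisections
import Literature.Topology.FourManifolds.TrisectionEulerProofs
import Literature.Topology.FourManifolds.HomotopyS4CompactProofs
import Literature.Topology.FourManifolds.HomotopyS4OrientableProofs
import Summits.SmoothPoincare4.SmoothPoincare4.Theorems.WeakReductionDescentMinimalWeaklyReducibleFromFourStubPigeonhole
import Summits.SmoothPoincare4.SmoothPoincare4.Theorems.WeakReductionDescentMinimalWeaklyReducibleFromFourStubTwoSided

/-!
# Crux `WeakReductionDescent.MinimalWeaklyReducibleFromFour` (stmt-SmoothPoincare4-18019) — line `Sketch`,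
# spine A = KCap (card `sector-haken-lemma-kcap`): Haken's lemma for the third handlebody

Skeleton of the lead prover (2026-08-17).  The crux X₂ says: every MINIMAL GK-trisection of genus
`g ≥ 4` of a smooth homotopy 4-sphere `M` (bare binders + `e : M ≃ₕ S⁴`) is weakly reducible.

The line (ideator-2's `Sketch.lean`, spine A) is MINIMALITY-FREE: `χ = 2` forces `g = k₀ + k₁ + k₂`
(PROVED tree theorem `gkTrisection_genus_eq_sum_of_homotopyEquiv_sphere_holds`), so `g ≥ 4` gives a
label `p` with `k_p ≥ 2`, i.e. a sector `X_p = ♮^{k_p}(S¹ × B³)` whose boundary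
`∂X_p = H_q ∪_F H_r ≅ #^{k_p}(S¹ × S²)` is a NON-PRIME 3-manifold; it carries BALANCED separating
reducing curves `δ` (bounding discs in `H_q` and `H_r`, with a core of the splitting on each side),
and by TWO-SIDEDNESS any non-separating compressing curve of the third handlebody `H_p` that misses
one such `δ` misses one of the two cores and is a weak reduction.  The apex `stub_sectorHaken`
("Haken's lemma survives one extra handlebody") asserts that such a `p`-curve exists off SOME
balanced `δ`.

Stubs (registered with `ledger skeleton check`; the two soft ones LANDED 2026-08-17, cycle 1 —
`Theorems/WeakReductionDescentMinimalWeaklyReducibleFromFourStubPigeonhole.lean` p165697,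
`…StubTwoSided.lean` p165745 — and are imported, so only the apex carries a `sorry`):
* `stub_pigeonhole` (S, LANDED): `e`, `IsGKTrisection M g k T`, `4 ≤ g` ⇒ `∃ p, 2 ≤ k p`.
* `stub_sectorHaken` (XL, APEX, open — the line's bet, minimality-free and unshielded): for a label
  `p` with `2 ≤ k p` there are a curve `δ ⊆ F` reducing for `(H_q, H_r)`, two `p`-cores `c₁, c₂`
  (non-separating curves bounding discs in both `H_q`, `H_r`) off `δ` and on different sides of it
  (no preconnected subset of `F ∖ δ` contains both), and a non-separating curve `c ⊆ F ∖ δ`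
  bounding a properly embedded disc in `H_p`.
* `stub_twoSided` (M, LANDED, point-set): the data above give `Trisection.IsWeaklyReducible T`.
Composition `MinimalWeaklyReducibleFromFour_of` is sorry-free: pigeonhole → apex → two-sidedness →
`Trisection.isWeaklyReducible_iff` (`Iff.rfl` to the crux clause).  Global minimality is carried
but not consumed (the line is the minimality-free horn of the dilemma; see PICKED.md / the card).
-/

open scoped Manifold ContDiff Topology ContinuousMap
open Set
open Literature.Topology.FourManifolds
open Summit.SmoothPoincare4.SmoothPoincare4.Theses.WeakReductionDescent

namespace Summit.SmoothPoincare4.SmoothPoincare4.Cruxes.MinimalWeaklyReducibleFromFour.KCap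

set_option linter.dupNamespace false

/-! ## The stubs -/

/-- **SectorHaken (XL, APEX).** Haken's lemma for the third handlebody: at a label `p` with
`k p ≥ 2` some balanced separating reducing curve `δ` of the sector boundary `∂X_p = H_q ∪_F H_r`
(cores `c₁`, `c₂` of the splitting on its two sides) admits a disjoint non-separating compressing
curve `c` of `H_p`.  Minimality-free and unshielded (it speaks about `S⁴`'s own trisections). -/
theorem stub_sectorHaken :
    ∀ (M : Type) [TopologicalSpace M] [T2Space M] [SecondCountableTopology M] [ChartedSpace (EuclideanSpace ℝ (Fin 4)) M] [IsManifold (𝓡 4) ((⊤ : ℕ∞) : WithTop ℕ∞) M], (M ≃ₕ (Metric.sphere (0 : EuclideanSpace ℝ (Fin 5)) 1)) → ∀ (g : ℕ) (k : Fin 3 → ℕ) (T : Fin 3 → Set M), Literature.Topology.FourManifolds.IsGKTrisection M g k T → 4 ≤ g → ∀ (p : Fin 3), 2 ≤ k p → ∃ (δ c₁ c₂ c : Set M), Literature.Topology.FourManifolds.Trisection.IsCurve T δ ∧ (∀ q : Fin 3, q ≠ p → Literature.Topology.FourManifolds.Trisection.BoundsDisc T (Literature.Topology.FourManifolds.Trisection.spineHandlebody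 T q) δ) ∧ (Literature.Topology.FourManifolds.Trisection.IsCurve T c₁ ∧ Literature.Topology.FourManifolds.Trisection.IsNonSeparating T c₁ ∧ ∀ q : Fin 3, q ≠ p → Literature.Topology.FourManifolds.Trisection.BoundsDisc T (Literature.Topology.FourManifolds.Trisection.spineHandlebody T q) c₁) ∧ (Literature.Topology.FourManifolds.Trisection.IsCurve T c₂ ∧ Literature.Topology.FourManifolds.Trisection.IsNonSeparating T c₂ ∧ ∀ q : Fin 3, q ≠ p → Literature.Topology.FourManifolds.Trisection.BoundsDisc T (Literature.Topology.FourManifolds.Trisection.spineHandlebody T q) c₂) ∧ Disjoint c₁ δ ∧ Disjoint c₂ δ ∧ (∀ S : Set M, S ⊆ Literature.Topology.FourManifolds.Trisection.centralSurfaceSet T \ δ → IsPreconnected S → c₁ ⊆ S → c₂ ⊆ S → False) ∧ Literature.Topology.FourManifolds.Trisection.IsCurve T c ∧ Literature.Topology.FourManifolds.Trisection.IsNonSeparating T c ∧ Literature.Topology.FourManifolds.Trisection.BoundsDisc T (Literature.Topology.FourManifolds.Trisection.spineHandlebody T p) c ∧ Disjoint c δ := by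
  sorry

/-! ## The composition, sorry-free, concluding the crux BY NAME -/

/-- **KCap composition**: pigeonhole → SectorHaken → two-sidedness → the crux clause (which is
`Trisection.IsWeaklyReducible T` by `Trisection.isWeaklyReducible_iff`, an `Iff.rfl`).  The crux is
stated UNFOLDED here so that only the closed skeleton theorem below concludes it by name. -/
theorem fromFour_of_kcap_pieces
    (h₁ : ∀ (M : Type) [TopologicalSpace M] [T2Space M] [SecondCountableTopology M] [ChartedSpace (EuclideanSpace ℝ (Fin 4)) M] [IsManifold (𝓡 4) ((⊤ : ℕ∞) : WithTop ℕ∞) M], (M ≃ₕ (Metric.sphere (0 : EuclideanSpace ℝ (Fin 5)) 1)) → ∀ (g : ℕ) (k : Fin 3 → ℕ) (T : Fin 3 → Set M), Literature.Topology.FourManifolds.IsGKTrisection M g k T → 4 ≤ g → ∃ p : Fin 3, 2 ≤ k p)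
    (h₂ : ∀ (M : Type) [TopologicalSpace M] [T2Space M] [SecondCountableTopology M] [ChartedSpace (EuclideanSpace ℝ (Fin 4)) M] [IsManifold (𝓡 4) ((⊤ : ℕ∞) : WithTop ℕ∞) M], (M ≃ₕ (Metric.sphere (0 : EuclideanSpace ℝ (Fin 5)) 1)) → ∀ (g : ℕ) (k : Fin 3 → ℕ) (T : Fin 3 → Set M), Literature.Topology.FourManifolds.IsGKTrisection M g k T → 4 ≤ g → ∀ (p : Fin 3), 2 ≤ k p → ∃ (δ c₁ c₂ c : Set M), Literature.Topology.FourManifolds.Trisection.IsCurve T δ ∧ (∀ q : Fin 3, q ≠ p → Literature.Topology.FourManifolds.Trisection.BoundsDisc T (Literature.Topology.FourManifolds.Trisection.spineHandlebody T q) δ) ∧ (Literature.Topology.FourManifolds.Trisection.IsCurve T c₁ ∧ Literature.Topology.FourManifolds.Trisection.IsNonSeparating T c₁ ∧ ∀ q : Fin 3, q ≠ p → Literature.Topology.FourManifolds.Trisection.BoundsDisc T (Literature.Topology.FourManifolds.Trisection.spineHandlebody T q) c₁) ∧ (Literature.Topology.FourManifolds.Trisection.IsCurve T c₂ ∧ Literature.Topology.FourManifolds.Trisection.IsNonSeparating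 T c₂ ∧ ∀ q : Fin 3, q ≠ p → Literature.Topology.FourManifolds.Trisection.BoundsDisc T (Literature.Topology.FourManifolds.Trisection.spineHandlebody T q) c₂) ∧ Disjoint c₁ δ ∧ Disjoint c₂ δ ∧ (∀ S : Set M, S ⊆ Literature.Topology.FourManifolds.Trisection.centralSurfaceSet T \ δ → IsPreconnected S → c₁ ⊆ S → c₂ ⊆ S → False) ∧ Literature.Topology.FourManifolds.Trisection.IsCurve T c ∧ Literature.Topology.FourManifolds.Trisection.IsNonSeparating T c ∧ Literature.Topology.FourManifolds.Trisection.BoundsDisc T (Literature.Topology.FourManifolds.Trisection.spineHandlebody T p) c ∧ Disjoint c δ)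
    (h₃ : ∀ (M : Type) [TopologicalSpace M] [ChartedSpace (EuclideanSpace ℝ (Fin 4)) M] (T : Fin 3 → Set M) (p : Fin 3) (δ c₁ c₂ c : Set M), (Literature.Topology.FourManifolds.Trisection.IsCurve T c₁ ∧ Literature.Topology.FourManifolds.Trisection.IsNonSeparating T c₁ ∧ ∀ q : Fin 3, q ≠ p → Literature.Topology.FourManifolds.Trisection.BoundsDisc T (Literature.Topology.FourManifolds.Trisection.spineHandlebody T q) c₁) → (Literature.Topology.FourManifolds.Trisection.IsCurve T c₂ ∧ Literature.Topology.FourManifolds.Trisection.IsNonSeparating T c₂ ∧ ∀ q : Fin 3, q ≠ p → Literature.Topology.FourManifolds.Trisection.BoundsDisc T (Literature.Topology.FourManifolds.Trisection.spineHandlebody T q) c₂) → Disjoint c₁ δ → Disjoint c₂ δ → (∀ S : Set M, S ⊆ Literature.Topology.FourManifolds.Trisection.centralSurfaceSet T \ δ → IsPreconnected S → c₁ ⊆ S → c₂ ⊆ S → False) → Literature.Topology.FourManifolds.Trisection.IsCurve T c → Literature.Topology.FourManifolds.Trisection.IsNonSeparating T c → Literature.Topology.FourManifolds.Trisection.BoundsDisc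 T (Literature.Topology.FourManifolds.Trisection.spineHandlebody T p) c → Disjoint c δ → Literature.Topology.FourManifolds.Trisection.IsWeaklyReducible T) :
    -- the crux `MinimalWeaklyReducibleFromFour`, UNFOLDED verbatim
    (∀ (M : Type) [TopologicalSpace M] [T2Space M] [SecondCountableTopology M] [ChartedSpace (EuclideanSpace ℝ (Fin 4)) M] [IsManifold (𝓡 4) ((⊤ : ℕ∞) : WithTop ℕ∞) M], (M ≃ₕ (Metric.sphere (0 : EuclideanSpace ℝ (Fin 5)) 1)) → ∀ (g : ℕ) (k : Fin 3 → ℕ) (T : Fin 3 → Set M), Literature.Topology.FourManifolds.IsGKTrisection M g k T → 4 ≤ g → (∀ (g' : ℕ) (k' : Fin 3 → ℕ) (T' : Fin 3 → Set M), Literature.Topology.FourManifolds.IsGKTrisection M g' k' T' → g ≤ g') → (let F : Set M := ⋂ l, T l; let H : Fin 3 → Set M := fun p => ⋂ (l : Fin 3) (_ : l ≠ p), T l; let IsCurve : Set M → Prop := fun c => c ⊆ F ∧ ∃ γ : (Metric.sphere (0 : EuclideanSpace ℝ (Fin 2)) 1) → M, Manifold.IsSmoothEmbedding (𝓡 1)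 (𝓡 4) ((⊤ : ℕ∞) : WithTop ℕ∞) γ ∧ Set.range γ = c; let BoundsDisc : Set M → Set M → Prop := fun A c => ∃ d : (Metric.closedBall (0 : EuclideanSpace ℝ (Fin 2)) 1) → M, Manifold.IsSmoothEmbedding (𝓡∂ 2) (𝓡 4) ((⊤ : ℕ∞) : WithTop ℕ∞) d ∧ Set.range d ⊆ A ∧ d '' ((𝓡∂ 2).boundary (Metric.closedBall (0 : EuclideanSpace ℝ (Fin 2)) 1)) = c ∧ Set.range d ∩ F = c; let NonSep : Set M → Prop := fun c => IsConnected (F \ c); let WeaklyReducible : Prop := ∃ (p : Fin 3) (c c' : Set M), IsCurve c ∧ IsCurve c' ∧ Disjoint c c' ∧ NonSep c ∧ NonSep c' ∧ BoundsDisc (H p) c ∧ ∀ q : Fin 3, q ≠ p → BoundsDisc (H q) c'; WeaklyReducible)) := by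
  intro M _ _ _ _ _ e g k T hT hg _hmin
  obtain ⟨p, hp⟩ := h₁ M e g k T hT hg
  obtain ⟨δ, c₁, c₂, c, -, -, hc₁, hc₂, hd₁, hd₂, hsides, hc, hcns, hcp, hcδ⟩ :=
    h₂ M e g k T hT hg p hp
  have hwr : Trisection.IsWeaklyReducible T :=
    h₃ M T p δ c₁ c₂ c hc₁ hc₂ hd₁ hd₂ hsides hc hcns hcp hcδ
  exact (Trisection.isWeaklyReducible_iff T).1 hwr

/-- **THE SKELETON THEOREM: the crux `MinimalWeaklyReducibleFromFour` BY NAME from the registered stubs.** -/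
theorem MinimalWeaklyReducibleFromFour_of : MinimalWeaklyReducibleFromFour :=
  fromFour_of_kcap_pieces
    Summit.SmoothPoincare4.SmoothPoincare4.Theorems.MinimalWeaklyReducibleFromFour.KCap.stub_pigeonhole
    stub_sectorHaken
    Summit.SmoothPoincare4.SmoothPoincare4.Theorems.MinimalWeaklyReducibleFromFour.KCap.stub_twoSided

end Summit.SmoothPoincare4.SmoothPoincare4.Cruxes.MinimalWeaklyReducibleFromFour.KCap
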